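import Summits.BirchSwinnertonDyer.Rank1Residual.F1Sign2.TwistSelmerRelaxedAtInfinityAtTwo
import Summits.BirchSwinnertonDyer.Rank1Residual.F1Sign2.AnalyticLineTransferAtTwo
import Summits.BirchSwinnertonDyer.Rank1Residual.F1Sign2.DescentSignAtTwo
import Mathlib.NumberTheory.Padics.PadicNumbers
import Mathlib.NumberTheory.NumberField.ClassNumber
import Literature.NumberTheory.EllipticCurves.Tamagawa
import Mathlib.RingTheory.TensorProduct.Basic
import HarnessLib

/-!
# Cell `bsd-f1-sign2`, lens `-desc` g10 (MEMO-desc §18): «THE SELMER UNITS OF THE 2-DIVISION FIELD DECIDE THE REAL SIGN — O-∞′ explained» —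
# the EXPLICIT (`ker N ⊂ L^×/L^{×2}`) side of the ∞-relaxed 2-Selmer group: carriers, the pigeonhole DESC-§18-P, the empirical law DESC-§18-A, supports T1–T3

STATEMENTS ONLY (definitions with bodies; the theorem-candidates DESC-§18-P `RelaxedSelmerUnitPigeonholeAtTwo`, T1 `NoMiddleSignTypeInRelaxedSelmerAtTwo`,
T2a `EggUnitForcesRelaxedIndexOneAtTwo`, T2b `TwistEggUnitForcesRelaxedIndexTwoAtTwo`, T3 `TotallyPositiveUnitPairForcesAscentAtTwo` as plain `def … : Prop`
(theorem-grade modulo the explicit dictionary — nothing asserted); the lead EMPIRICAL law DESC-§18-A `AscentRequiresSelmerUnitAtTwo` as `@[conjecture] def`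
(open obligation, nothing asserted); DESC-§18-A⁺ `LargeRelaxedSelmerContainsUnitAtTwo` DROPPED from the filing (refuted statement; -desc: «do NOT file as a candidate»); no theorem, no named Literature fact, no `sorry`;
no `instance` — the cubic algebra is the `abbrev twoDivisionAlgebra W := AdjoinRoot (twoDivisionUCubic W)` and DESC-§18-P carries `[NumberField (twoDivisionAlgebra W)]`
as a BINDER (a Prop-valued mixin over Mathlib's `AdjoinRoot.instField` under `[Fact (Irreducible …)]`), per the typer lint rule).

TYPER FILING (seat `bsd-f1-sign2-ty` g4; CANDIDATES.md rows DESC-§18-P / DESC-§18-A / DESC-§18-A⁺ / DESC-§18-T): bodies VERBATIM from the planner's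
`HOME/MEMO-desc-data/g10/Sketch-v13.lean` 9789045055a049c5 (-desc g10 2026-08-28T01:51:01Z; MEMO-desc.md f90385bcf7e9d83a §18; data `MEMO-desc-data/g10/` 29 files,
SHA16SUMS; lean rc 0 · 0 err · 0 warn · 0 sorry per -desc; BC7 `Probe-v13.out` b487b10a8521e4dd 7/7 CLEAN); edits = this header, the `@[conjecture]` tag on
DESC-§18-A (cell convention: conjecture-flagged laws land as `@[conjecture] def`), and two cite tags added on the egg / twist-egg sign-type carriers per
REF2 v16 §44 (a) ([BrumerKramer1977 §2] + [YooYu2022 Def. 2.1 / §3.1], bib key `YooYu2022` added by the typer). CENSUS of record (planner's, quoted): kit j296051 (126 523 Cremona curves,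
conductor < 5·10⁵, two engines per quantity, 0 failures) + j296388 (84 649 curves, rank 2/3/4 frames): DESC-§18-P dimension inequality 210 905/210 905
(equality 97 140; typed hypothesis 88 452, all forced), DESC-§18-A 513/513 (E(W) = ∅ ⇒ DOWN 1 228/1 228), T1 0 middle-type classes in 126 523, T3 27/27,
A⁺ refuted (132 counterexamples, e.g. 141895c1, 133551a1). REF1-AUDIT-v1 §60 (37798a9196302d60, 2026-08-28T02:57:34Z; evidence `HOME/REF1-data/b60/`; Sketch-v13 9789045055a049c5 probed verbatim = this draft + `@[conjecture]` on §18-A): **DESC-§18-P `RelaxedSelmerUnitPigeonholeAtTwo` SURVIVES THEOREM-GRADE — and its `p = 2` clause IS A THEOREM (local duality, three steps, uniform in `v`: rank of the Kummer valuation parities above `v` ≤ dim Im(H¹_nr → H¹(𝔽_v, Φ_v))[2] ≤ v₂(c_v)); §18-T1/T2a/T2b/T3 THEOREM-GRADE (in-print assembly: PR 4.11/4.14 + twist-invariance of `q`; Poitou–Tate line at ∞, MR Lemma 3.2); §18-A SURVIVES conjecture-grade (`@[conjecture]` ✓, 513/513, P forces 638/695); §18-A⁺ REFUTED by -desc's own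 census j296388 (132 counterexamples) — dropped from this file per REF1 (`--drop-aplus`; kept as a recorded negative in MEMO-desc §18 / CANDIDATES row DESC-§18-A⁺); BC7 7/7 CLEAN (P 17.9 s/6.7/6.2; A 1.3/0.9/1.0; T1 10.3/5.7/2.0/8.8; T2a 22.8/1.5/1.3/7.3; T2b 9.8/1.4/1.3/6.9; T3 17.2/5.5/12.6/24.4; A⁺ 9.3/6.0/6.0); carriers pinned, `tamagawaTwoValuationAt` INTRINSIC (tree `localTamagawaNumber` on the minimal model, no junk-model escape), binder `[NumberField (twoDivisionAlgebra W)]` = Prop mixin, fine; ∃-junk none; mutation (information): `0 < W.Δ` unused by P's proof (widenable), `IsNormOneUnitAtTwo` in T2a/T2b decoration, A's population hypotheses load-bearing by design; docstring nits n1 (P: duality proof replaces «checked numerically»), n2 (T1: `q_∞` twist-invariance) folded below; n3: the §18.6 symmetry step is EXACT in the `S ↔ S′`-symmetric null model (UP for `S` at rank r ⟺ DOWN for `S′` at rank r + 1, so `P(UP | r) ≈ 2^{−r}` from the PR weights) — a statement about the MODEL, correctly labelled, not typed here. **-ty CLEARED TO FILE with `--drop-aplus` + n1–n3.** REF2-PLACEMENT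 v16 §44 (b75380ddc2d9a8e1, 2026-08-28T01:54:12Z, D-desc-ref2-18 ANSWERED): (a) the §18.1 dictionary = IN PRINT / classical, CONFIRMED — Brumer–Kramer 1977's archimedean condition is quoted verbatim as `Ṽ = {(1,1,1),(1,−1,−1)}` w.r.t. the root ordering in Yoo–Yu 2022 (PJM 320) Def. 2.1 / §3.1 [corpus: arxiv-2005.00194 p0006 L11–40, p0010 L8–16], whose SEMI-NARROW class group `C_L^∞` is exactly the planner's sign-modified class group (cite added on the sign-type carriers); `[R : Sel_str] = 2` = MR2010 Lemma 3.2 (v16 §35); (b) T1 = Poonen–Rains 2012 Prop. 4.11 / Thm. 4.14 reciprocity with `q_∞ ≠ 0` only on the middle type [arxiv-1009.0287 p0015] — KNOWN, theorem-grade support; T2 definitional, T3 a dimension count; (c) the §18.4 law (DESC-§18-A): mechanism «unit signatures of the cubic field control Sel₂» in print only under NICE-reduction hypotheses and for dim Sel₂ (Washington 1987, Kawachi–Nakano 1992 Thms 1–2, BK77 §7, Schaefer 1996, Yoo–Yu Thm 1.6, Li 2019, BPT); the real-image bit on the `Ш[2] = 𝔽₂²` population decided by Selmer-unit sign types, arbitrary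 reduction — NOT FOUND; NEW-COMBINATION agreed; (d) DESC-§18-P: the odd-`p` ramified bound in print in substance (BK77 §3; Schaefer–Stoll 2004 §3; Schaefer 1996 S-version); **the `p = 2` clause with no extra term is NOT LOCATED** (Yoo–Yu reach even primes only under lower/upper-NICE, Def. 1.5 / Thm. 1.6; BK77 semistable) ⇒ in-print assembly for odd `p` + ONE unlocated local lemma at `2` (= REF1's item (1)); theorem-grade; beyond-print candidate-small iff that lemma is proved; (e) §18.6 `2^{−r}` = aggregate equidistribution prediction (Bhargava–Gross Thm 12.4 via Poonen–Stoll Thm 26), the deficit not recorded in print (conditioning/ordering caveat; BHKSSW height check); (f) A empirical, not in print; A⁺ the planner's own kill. Refuted in print: nothing. PARTITION: none moved; beyond-print theorem: no. bears_on: O-∞′ (REF1 §48 /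
MEMO-desc §17.12), `stmt-BirchSwinnertonDyer-19099` via the -desc rows; answers D-es-13, AN-23 (a)(c), D-an-18 per MEMO-desc §18.

Planner's summary (verbatim): # Sketch-v13 (planner `-desc` g10, MEMO-desc §18): unit signatures of the cubic `2`-division field filtered through the
Kummer conditions — the EXPLICIT (`ker N ⊂ L^×/L^{×2}`) side of the ∞-relaxed `2`-Selmer group `selmerGroupRelaxedAtInfinityAtTwo W`.

Carriers reused from the tree: `twoDivisionUCubic W = X³ + b₂X² + 8b₄X + 16b₆` and `IsBranchRealRoot`
(`F1Sign2/AnalyticLineTransferAtTwo.lean`), `selmerGroupRelaxedAtInfinityAtTwo`, `WeierstrassCurve.selmerGroup`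
(`F1Sign2/TwistSelmerRelaxedAtInfinityAtTwo.lean`), `selmerTwoCard` (`F1Sign2/DescentSignAtTwo.lean`), `WeierstrassCurve.mordellWeilRank`.
New explicit-side predicates (definitions with body): `twoDivisionAlgebra`, `IsNormOneUnitAtTwo`, `HasEggSignTypeAtTwo`,
`HasTwistEggSignTypeAtTwo`, `HasMiddleSignTypeAtTwo`, `InExplicitLocalKummerImageAtTwo`.
LAW rows (g10 census, kit `j296051` = 126 523 Cremona curves, two engines, 0 failures; `j296388` = rank 2/3/4 frames):
`AscentRequiresSelmerUnitAtTwo` (DESC-§18-A, lead empirical law, 513/513 ⟺ `E(W) = ∅ ⇒ down` 1 228/1 228),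
`LargeRelaxedSelmerContainsUnitAtTwo` (DESC-§18-A⁺, REFUTED by `j296388`: typed negative), `RelaxedSelmerUnitPigeonholeAtTwo` (DESC-§18-P, LEAD, theorem-grade), `TotallyPositiveUnitPairForcesAscentAtTwo` (T3, support).
Statements only (`def … : Prop`); nothing asserted; no `sorry`.
-/


noncomputable section

open scoped Classical TensorProduct

open WeierstrassCurve Polynomial NumberField

namespace Summit.BirchSwinnertonDyer.Rank1Residual.F1Sign2

/-- The cubic `2`-division algebra `L_W = ℚ[X]/(c_W)`, `c_W = twoDivisionUCubic W` (`= ℚ(W[2] ∖ 0)` as a cubic field when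
`W(ℚ)[2] = 0`, i.e. when `c_W` is irreducible); `θ = AdjoinRoot.root c_W`. By Cassels / Schaefer–Stoll,
`H¹(ℚ, W[2]) ≅ ker (N : L_W^×/L_W^{×2} → ℚ^×/ℚ^{×2})`, the Kummer map being `P ↦ X(P) − θ` (`X = 4x` on the model `Y² = c_W(X)`). [folklore] -/
abbrev twoDivisionAlgebra (W : WeierstrassCurve ℚ) : Type := AdjoinRoot (twoDivisionUCubic W)

/-- `α ∈ L_W` is a UNIT OF NORM `+1` of the ring of integers: integral over `ℤ` with `N_{L/ℚ}(α) = 1` (then `α⁻¹ = α'α''` is integral too).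
Its square class lies in `ker N`, i.e. is a class of `H¹(ℚ, W[2])`, unramified at every odd prime. -/
def IsNormOneUnitAtTwo (W : WeierstrassCurve ℚ) (α : twoDivisionAlgebra W) : Prop :=
  IsIntegral ℤ α ∧ Algebra.norm ℚ α = 1

/-- EGG sign type `(+,−,−)` (for `Δ_W > 0`, real roots `e₁ < e₂ < e₃` of `c_W`): under every real embedding `σ` of `L_W`, `σ α ≠ 0` and
`σ α > 0` iff `σ θ` is the SMALLEST real root. This is the real Kummer class `δ_∞` of the egg `W(ℝ) ∖ W⁰(ℝ)` (a point with `e₁ ≤ X ≤ e₂` has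
`X − e₁ > 0 > X − e₂, X − e₃`), i.e. the non-trivial element of `L_∞(W) = δ_∞(W(ℝ)) ⊂ H¹(ℝ, W[2]) ≅ 𝔽₂²`.
[cite: BrumerKramer1977, §2 (archimedean condition)] [cite: YooYu2022, Def. 2.1 and §3.1 (semi-narrow class group)] -/
def HasEggSignTypeAtTwo (W : WeierstrassCurve ℚ) [Fact (Irreducible (twoDivisionUCubic W))] (α : twoDivisionAlgebra W) : Prop :=
  ∀ σ : twoDivisionAlgebra W →+* ℝ, σ α ≠ 0 ∧
    (0 < σ α ↔ IsBranchRealRoot (twoDivisionAlgebra W) σ (twoDivisionUCubic W) (AdjoinRoot.root (twoDivisionUCubic W)) false)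

/-- TWIST-EGG sign type `(−,−,+)`: `σ α > 0` iff `σ θ` is the LARGEST real root — the egg class of the twist `W^{(−1)}`, i.e. the
non-trivial element of the other `q_∞`-isotropic line `L_∞(W^{(−1)}) ⊂ H¹(ℝ, W[2])`.
[cite: BrumerKramer1977, §2 (archimedean condition)] [cite: YooYu2022, Def. 2.1 and §3.1 (semi-narrow class group)] -/
def HasTwistEggSignTypeAtTwo (W : WeierstrassCurve ℚ) [Fact (Irreducible (twoDivisionUCubic W))] (α : twoDivisionAlgebra W) : Prop :=
  ∀ σ : twoDivisionAlgebra W →+* ℝ, σ α ≠ 0 ∧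
    (0 < σ α ↔ IsBranchRealRoot (twoDivisionAlgebra W) σ (twoDivisionUCubic W) (AdjoinRoot.root (twoDivisionUCubic W)) true)

/-- MIDDLE sign type `(−,+,−)`: `σ α > 0` iff `σ θ` is the MIDDLE real root — the `q_∞`-ANISOTROPIC vector of `H¹(ℝ, W[2])`
(`q_∞(T_j) = sign c_W'(e_j)` in the theta-group normalisation). -/
def HasMiddleSignTypeAtTwo (W : WeierstrassCurve ℚ) [Fact (Irreducible (twoDivisionUCubic W))] (α : twoDivisionAlgebra W) : Prop :=
  ∀ σ : twoDivisionAlgebra W →+* ℝ, σ α ≠ 0 ∧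
    (0 < σ α ↔
      (¬ IsBranchRealRoot (twoDivisionAlgebra W) σ (twoDivisionUCubic W) (AdjoinRoot.root (twoDivisionUCubic W)) false ∧
        ¬ IsBranchRealRoot (twoDivisionAlgebra W) σ (twoDivisionUCubic W) (AdjoinRoot.root (twoDivisionUCubic W)) true))

/-- EXPLICIT LOCAL KUMMER CONDITION at a prime `p`: the square class of `α` lies in `δ_p(W(ℚ_p)) ⊂ (L_W ⊗ ℚ_p)^×/□`, spelled out:
for some finite set of rational `X`-coordinates of `ℚ_p`-points (`c_W(X) ∈ ℚ_p^{×2}`; rational `X` suffice by local constancy, and products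
are needed because the image is the GROUP generated by the `X − θ`), `α · ∏ (X − θ)` is a square in `L_W ⊗_ℚ ℚ_p = ∏_{𝔓 ∣ p} L_{W,𝔓}`.
(`dim_{𝔽₂} δ_p = dim W(ℚ_p)[2] + [p = 2]`; at a good odd `p` it is the unramified subgroup.) [cite: BrumerKramer1977, §2] -/
def InExplicitLocalKummerImageAtTwo (W : WeierstrassCurve ℚ) (p : ℕ) [Fact p.Prime] (α : twoDivisionAlgebra W) : Prop :=
  ∃ s : Finset ℚ,
    (∀ X ∈ s, aeval X (twoDivisionUCubic W) ≠ 0 ∧ IsSquare ((aeval X (twoDivisionUCubic W) : ℚ) : ℚ_[p])) ∧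
      IsSquare
        ((α * ∏ X ∈ s, (AdjoinRoot.of (twoDivisionUCubic W) X - AdjoinRoot.root (twoDivisionUCubic W))) ⊗ₜ[ℚ] (1 : ℚ_[p]) :
          twoDivisionAlgebra W ⊗[ℚ] ℚ_[p])

/-- **DESC-§18-T2a (support, theorem-grade: dictionary + MR 2010 Lemma 3.2 at `T = {∞}`).** `Δ_W > 0`, `W(ℚ)[2] = 0`: a norm-one UNIT of
`L_W` of EGG sign type that satisfies the Kummer condition at every prime is a class of `Sel₂(W)` with non-zero restriction at `∞`; hence
`Sel₂(W)` is NOT strict at `∞` and `[Sel^{rel ∞}_2(W) : Sel₂(W)] = 1` (the «down» branch of `SelmerIndexInRelaxedAtInfinityAtTwo`).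
Census (kit j296051, engines A+B): see MEMO-desc §18. [cite: MazurRubin2010, Lemma 3.2] [cite: BrumerKramer1977, §2] -/
def EggUnitForcesRelaxedIndexOneAtTwo : Prop :=
  ∀ (W : WeierstrassCurve ℚ) [W.IsElliptic] [Fact (Irreducible (twoDivisionUCubic W))], 0 < W.Δ →
    ∀ α : twoDivisionAlgebra W, IsNormOneUnitAtTwo W α → HasEggSignTypeAtTwo W α →
      (∀ (p : ℕ) [Fact p.Prime], InExplicitLocalKummerImageAtTwo W p α) →
        (W.selmerGroup ((2 : ℕ) : ℤ)).relIndex (selmerGroupRelaxedAtInfinityAtTwo W) = 1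

/-- **DESC-§18-T2b (support, theorem-grade, twin).** A norm-one unit of TWIST-EGG sign type satisfying every Kummer condition is a class of
`Sel^{rel ∞}_2(W) ∖ Sel₂(W)`; hence `Sel₂(W)` IS strict at `∞` and `[Sel^{rel ∞}_2(W) : Sel₂(W)] = 2` (the «up» branch: every
descent-admissible twist gains Selmer rank, `TwistSelmerEqRelaxedAtInfinityAtTwo`). [cite: MazurRubin2010, Lemma 3.2] [cite: BrumerKramer1977, §2] -/
def TwistEggUnitForcesRelaxedIndexTwoAtTwo : Prop :=
  ∀ (W : WeierstrassCurve ℚ) [W.IsElliptic] [Fact (Irreducible (twoDivisionUCubic W))], 0 < W.Δ →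
    ∀ α : twoDivisionAlgebra W, IsNormOneUnitAtTwo W α → HasTwistEggSignTypeAtTwo W α →
      (∀ (p : ℕ) [Fact p.Prime], InExplicitLocalKummerImageAtTwo W p α) →
        (W.selmerGroup ((2 : ℕ) : ℤ)).relIndex (selmerGroupRelaxedAtInfinityAtTwo W) = 2

/-- **DESC-§18-T1 (support, theorem-grade: the `2–∞` coupling = quadratic reciprocity for the Poonen–Rains form).** `Δ_W > 0`,
`W(ℚ)[2] = 0`: NO element of `ker N` satisfying the Kummer condition at every prime has MIDDLE sign type — the image of
`Sel^{rel ∞}_2(W)` in `H¹(ℝ, W[2]) ≅ 𝔽₂²` avoids the `q_∞`-anisotropic vector, so it is one of the two isotropic lines `L_∞(W)`,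
`L_∞(W^{(−1)})` (it has order exactly `2` by MR 2010 Lemma 3.2). Proof sketch: the local Kummer images are `q_v`-isotropic
(Poonen–Rains Prop. 4.11), `Σ_v q_v = 0` on global classes (Thm. 4.14), and `q_∞(T_middle) ≠ 0`. Here `q_∞` is the SAME form for `W` and
`W^{(−1)}` (`W^{(−1)}[2] = W[2]` with the same Heisenberg group — Mumford's `e_*^𝓛 ≡ 1`, the fact KMR 2013 §5 uses to put all twisted Selmer
structures in one quadratic space), whence the zero set of `q_∞` is `{0, egg, twist-egg}` and the middle type is the anisotropic vector (REF1 §60 n2).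
[cite: KlagsbrunMazurRubin2013, §5] A pure statement about the cubic
field and the local images; census: 0 middle-type classes in 126 523 relaxed Selmer groups (kit j296051: 126 256 curves with `Δ > 0`). [cite: PoonenRains2012, Prop. 4.11, Thm. 4.14] -/
def NoMiddleSignTypeInRelaxedSelmerAtTwo : Prop :=
  ∀ (W : WeierstrassCurve ℚ) [W.IsElliptic] [Fact (Irreducible (twoDivisionUCubic W))], 0 < W.Δ →
    ∀ α : twoDivisionAlgebra W, (∃ q : ℚ, q ≠ 0 ∧ Algebra.norm ℚ α = q ^ 2) →
      (∀ (p : ℕ) [Fact p.Prime], InExplicitLocalKummerImageAtTwo W p α) → ¬ HasMiddleSignTypeAtTwo W α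


/-- `α` passes EVERY finite local Kummer condition (membership of its square class in the ∞-relaxed Selmer group on the explicit side). -/
def PassesAllKummerConditionsAtTwo (W : WeierstrassCurve ℚ) (α : twoDivisionAlgebra W) : Prop :=
  ∀ (p : ℕ) [Fact p.Prime], InExplicitLocalKummerImageAtTwo W p α

/-- `α` is a SELMER UNIT of `W`: a norm-one unit of `L_W`, not a square (a non-trivial class of `U₁(L_W)/□ ≅ 𝔽₂²` when `Δ_W > 0`),
passing every finite Kummer condition — an element of `E(W) := U₁(L_W)/□ ∩ Sel^{rel ∞}_2(W)` in the notation of MEMO-desc §18. -/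
def IsSelmerUnitAtTwo (W : WeierstrassCurve ℚ) (α : twoDivisionAlgebra W) : Prop :=
  IsNormOneUnitAtTwo W α ∧ ¬ IsSquare α ∧ PassesAllKummerConditionsAtTwo W α

/-- **DESC-§18-A (LEAD, empirical law; conjecture-flagged).** «NO SILENT ASCENT»: for `W/ℚ` with `Δ_W > 0`, `W(ℚ)[2] = 0`, rank `0` and
`Sel₂(W) ≅ (ℤ/2)²` (so `Ш(W)[2] ≅ (ℤ/2)²`), the UP branch (`Sel₂(W)` strict at `∞`, `[Sel^{rel ∞}_2 : Sel₂] = 2`, every descent-admissible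
twist GAINS Selmer rank) forces a SELMER UNIT: some norm-one unit class of the cubic field `ℚ(W[2])` passes every finite Kummer condition.
Contrapositive (the cell's O-∞′ reading): if no unit of `ℚ(W[2])` is everywhere-locally a Kummer class, `Ш(W)[2]` contains a class that is
negative at the egg (`res_∞ ≠ 0`, DOWN). CENSUS = BC5 witness (kit `j296051`, all 15 382 such curves of conductor `< 5·10⁵`, engines A+B):
UP ⇒ `E(W) ≠ ∅` in 513/513; `E(W) = ∅` ⇒ DOWN in 1 228/1 228; moreover UP ⇒ `E(W) ∋` a twist-egg-type unit in 456/513, `E(W) = U₁` totally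
positive in 27, `E(W)` = one totally positive class in 30. WHY IT MIGHT FAIL: nothing structural puts a unit into the 3-dimensional
`Sel^{rel ∞}_2 = Ш[2] ⊕ ⟨η⟩`; with many bad primes of even Tamagawa number a unit-free UP group is conceivable (UP with ≥ 4 odd bad primes: 20/2 833
curves only) — the law is a dimension effect (`U₁/□` of dim 2 and `Sel^{rel ∞}` of dim 3 inside the small space of classes unramified outside `2N`). -/
@[conjecture] def AscentRequiresSelmerUnitAtTwo : Prop :=
  ∀ (W : WeierstrassCurve ℚ) [W.IsElliptic] [Fact (Irreducible (twoDivisionUCubic W))], 0 < W.Δ →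
    W.mordellWeilRank = 0 → selmerTwoCard W = 4 →
      (W.selmerGroup ((2 : ℕ) : ℤ)).relIndex (selmerGroupRelaxedAtInfinityAtTwo W) = 2 →
        ∃ α : twoDivisionAlgebra W, IsSelmerUnitAtTwo W α

/-- **DESC-§18-T3 (support, theorem-grade modulo the explicit dictionary).** `Δ_W > 0`, `W(ℚ)[2] = 0`, `#Sel₂(W) = 4`: two independent
TOTALLY POSITIVE Selmer units fill `Sel₂(W)` (totally positive classes restrict to `0` at `∞`, so they lie in `Sel₂`; three non-trivial
classes), hence `res_∞(Sel₂(W)) = 0` — the UP branch. Census: `E(W) = U₁/□` totally positive ⇒ UP, 27/27 (kit `j296051`). -/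
def TotallyPositiveUnitPairForcesAscentAtTwo : Prop :=
  ∀ (W : WeierstrassCurve ℚ) [W.IsElliptic] [Fact (Irreducible (twoDivisionUCubic W))], 0 < W.Δ → selmerTwoCard W = 4 →
    ∀ α β : twoDivisionAlgebra W, IsSelmerUnitAtTwo W α → IsSelmerUnitAtTwo W β → ¬ IsSquare (α * β) →
      (∀ σ : twoDivisionAlgebra W →+* ℝ, 0 < σ α ∧ 0 < σ β) →
        (W.selmerGroup ((2 : ℕ) : ℤ)).relIndex (selmerGroupRelaxedAtInfinityAtTwo W) = 2


/-- `2`-adic valuation of the local Tamagawa number `c_v(W) = [W(ℚ_v) : W₀(ℚ_v)]` at a finite place `v` of `ℚ` (computed on the `v`-minimal model;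
`= 0` at places of good reduction, so the `finsum` below is a finite sum). -/
def tamagawaTwoValuationAt (W : WeierstrassCurve ℚ) (v : IsDedekindDomain.HeightOneSpectrum (𝓞 ℚ)) : ℕ :=
  padicValNat 2 ((W.baseChange (v.adicCompletion ℚ)).localTamagawaNumber (v.adicCompletionIntegers ℚ))

/-- **DESC-§18-P (LEAD typed candidate; theorem-grade modulo the explicit dictionary — the TAMAGAWA-PARITY PIGEONHOLE).** `Δ_W > 0`, `W(ℚ)[2] = 0`,
`L = L_W` the cubic field: `dim_{𝔽₂} Sel^{rel ∞}_2(W) ≤ e(W) + rk₂ Cl(L) + Σ_{p ∣ N} dim_{𝔽₂} Φ_p(𝔽_p)[2] ≤ e(W) + v₂(h_L) + Σ_p v₂(c_p(W))`, where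
`e(W) = dim (Sel^{rel ∞}_2 ∩ U₁(L)/□)` is the Selmer-unit dimension: valuations of a relaxed Selmer class are even outside `2N` (Kummer image =
unramified classes at good odd `p`), its odd-valuation pattern at `p ∣ 2N` lies in the image of `W(ℚ_p)/W₀(ℚ_p) ↠ Φ_p(𝔽_p)/2` (Brumer–Kramer §3 for odd `p`;
at EVERY `v`, `p = 2` included, a THEOREM by local duality — REF1-AUDIT §60 A2: the `𝔽₂`-rank of the valuation parities of `δ_v(W(ℚ_v))`
is `≤ dim Im(H¹_nr(ℚ_v, W[2]) → H¹(𝔽_v, Φ_v))[2] ≤ v₂(c_v)` (Hilbert-symbol parity with the unramified classes, Tate isotropy of `δ_v`, and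
Lang–Néron `H¹_nr ∩ δ_v = ker(H¹_nr → H¹(𝔽_v, Φ_v))` [cite: MilneADT2006, I.3.8]); census 0 exceptions in 210 905), even-valuation classes map to `Cl(L)[2]` with kernel the norm-one unit classes. Typed in its first
non-trivial instance: if `#Sel^{rel ∞}_2(W) > 2^{v₂(h_L) + Σ_v v₂(c_v)}` then `W` HAS A SELMER UNIT. CENSUS = BC5 witness (kit `j296051` +
`j296388`, 210 905 curves with `Δ > 0` of conductor `< 5·10⁵`, ranks 0–4): the dimension inequality holds in 210 905/210 905 with EQUALITY in
97 140; the typed hypothesis holds for 88 452 curves, each with a Selmer unit (forced). It EXPLAINS DESC-§18-A: 638 of the 695 `Ш`-type groups of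
dimension 3 are forced; and the `v₂(N)`-law of REF1 §48 (MEMO-desc §18). WHY IT MIGHT FAIL: not through the `p = 2` clause (proved, REF1 §60);
only the explicit Cassels/Schaefer–Stoll dictionary between the typed carriers and `H¹(ℚ, W[2])` is unformalised (theorem-grade in-print assembly). [cite: BrumerKramer1977, §3, §7] -/
def RelaxedSelmerUnitPigeonholeAtTwo : Prop :=
  ∀ (W : WeierstrassCurve ℚ) [W.IsElliptic] [Fact (Irreducible (twoDivisionUCubic W))] [NumberField (twoDivisionAlgebra W)], 0 < W.Δ →
    2 ^ (padicValNat 2 (NumberField.classNumber (twoDivisionAlgebra W)) +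
          ∑ᶠ v : IsDedekindDomain.HeightOneSpectrum (𝓞 ℚ), tamagawaTwoValuationAt W v) <
        Nat.card (selmerGroupRelaxedAtInfinityAtTwo W) →
      ∃ α : twoDivisionAlgebra W, IsSelmerUnitAtTwo W α

end Summit.BirchSwinnertonDyer.Rank1Residual.F1Sign2

end
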